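import Summits.AtomisticToContinuum.Crystallization.Theorems.ContactSaturationLadderChunkNear
import Summits.AtomisticToContinuum.Crystallization.Theorems.ContactSaturationLadderWindowFilling
import Summits.AtomisticToContinuum.Crystallization.Theorems.PalmUnimodularRigidityUnimodularEnergyLowerBoundCluster
import HarnessLib

/-!
# ContactSaturationLadderSiteFloor — the FIRST PROVED RUNGS of the pricing ladder of crux `LooseTextureRung`:
explicit pointwise floors `SiteFloor δ m`, explicit SLACK, explicit dip threshold (helper, supports item 30303)

Helper for route `ContactSaturationLadder` (sub-problem `Crystallization`), crux `LooseTextureRung`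
(stmt-AtomisticToContinuum-30303, DECLARED RESIDUAL-CORE), registered line «DialFreeSieveV6» v6.3 (lens-1 lineage `decomp-a2c-lens-1`,
cell `decomp-a2c`; the registered skeleton and its stubs are UNTOUCHED — nothing here is a registered item).  Continues the helper
modules `ContactSaturationLadderChunkDoor` / `…ChunkProfile` / `…ChunkNear` (p801948 · p802164 · p803176; same namespace, marker-generic,
Theses-free).  Source: the lineage node g25 (`LooseTextureRung_node_g25.lean`, §33, kernel-checked there against the tree item).  Every
statement below is PROVED (0 sorry, standard axioms).

`…ChunkNear` §7 typed the GS-free, `N`-free POINTWISE FLOOR `SiteFloor d m` («every particle of an injective `d`-separated configuration of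
`ℝ³` has Lennard-Jones site energy `≥ m`») and proved that a floor at the proved ground-state separation `7/10` with `e⋆ ≤ m/2 + σ` IS the
far-side SLACK(σ) of the priced cut NLC ⟸ PAY(κ₀) ∧ SLACK(σ) ∧ «Φ_∞(F) < κ₀/(κ₀+σ)» — but NO rung of the `(d, m)` ladder was a theorem.
This file proves two, and makes the far side of the priced cut carry no unproved constant.

## Contents

§8 (R1) `siteFloor_of_separated` : `SiteFloor δ (−(250/6)·δ⁻⁶)`, every `δ > 0` (drop the repulsion; Literature shell sum `sum_inv_pow_six_le`);
   (R2) `siteFloor_core_tail` : `SiteFloor δ (−(1/12)((2r/δ+1)³ − 1) − (250/6)·δ⁻³·r⁻³)`, `0 < δ ≤ r` (the `≤ (2r/δ+1)³ − 1` neighbours within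
   `r` cost at most the WELL DEPTH `1/12` each — Literature `neg_one_div_le_lennardJones`, `card_le_of_separated_of_dist_le` —, the rest is
   the two-scale tail `ContactSaturationLadderWindowFilling.sum_inv_pow_six_le_two_scale_idx` (as in `ContactSaturationLadderCrossTermFloor.site_tail`,
   whose module lies in the route's Theses cone and is therefore not imported)); at `δ = 7/10`, `r = 19/10`: `siteFloor_seven_tenths_forty :
   SiteFloor (7/10) (−40)`; THE EXPLICIT SLACK `markedSlack_twenty : MarkedSlack F 20` for EVERY marker (`UnimodularEnergy.eStar_nonpos`); NEAR(φ) ⟸ PAY(κ₀) alone for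
   `φ(κ₀+20) < κ₀` (`markedNearGapAt_of_pay_twenty`); THE EXPLICIT-THRESHOLD CUT `noLooseChunks_of_pay_dip_twenty` : CEIL → PAY(κ₀) →
   «Φ_∞(F) < κ₀/(κ₀+20)» → NLC, with its one-rung / one-door forms.
HONEST VALUE (recorded for the cell critic, CRITIC-LEDGER rows 283/295): at the census near price `κ₀ ≈ 5.5·10⁻⁴` the proved threshold is
`≈ 2.7·10⁻⁵`; the census rung `m(7/10) ≈ −3.27` (σ ≈ 0.92) needs a certified kissing-energy computation; these rungs move no load off the
crux's residual — they are where theorems start on the `(d, m)` ladder.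
-/

noncomputable section

open scoped BigOperators Topology Classical
open Filter Metric
open Literature.MathematicalPhysics.StatisticalMechanics (lennardJones IsGroundState siteEnergy sum_inv_pow_six_le
  neg_one_div_le_lennardJones neg_le_lennardJones_of_le card_le_of_separated_of_dist_le)
open Summit.AtomisticToContinuum.Crystallization.Theorems.ChargedEnergyGapNegative (eStar)
open Summit.AtomisticToContinuum.Crystallization.Theorems
open Summit.AtomisticToContinuum.Crystallization.Theorems.ContactSaturationLadderWindowFilling (sum_inv_pow_six_le_two_scale_idx)
open Summit.AtomisticToContinuum.Crystallization.Theorems.UnimodularEnergy (eStar_nonpos)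

namespace Summit.AtomisticToContinuum.Crystallization.Theorems.ContactSaturationLadderChunkDoor

/-! ## §8 Explicit rungs of the pointwise floor, explicit SLACK, explicit dip threshold -/

/-- **(R1) THE SHELL-SUM RUNG**: `SiteFloor δ (−(250/6)·δ⁻⁶)` for every `δ > 0` (cf. `PhononSlackCertificatesAllBadGapFloor.neg_le_siteEnergy_of_separated`,
restated in the `SiteFloor` currency). -/
theorem siteFloor_of_separated {δ : ℝ} (hδ : 0 < δ) : SiteFloor δ (-(250 / 6 * δ⁻¹ ^ 6)) := by
  intro N y _ hsep i
  have hS := sum_inv_pow_six_le y hδ hsep i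
  unfold siteEnergy
  calc -(250 / 6 * δ⁻¹ ^ 6) ≤ -(1 / 6) * ∑ k ∈ Finset.univ.erase i, (dist (y i) (y k))⁻¹ ^ 6 := by nlinarith
    _ = ∑ k ∈ Finset.univ.erase i, -(1 / 6 * (dist (y i) (y k))⁻¹ ^ 6) := by
        rw [Finset.mul_sum]
        refine Finset.sum_congr rfl fun k _ => ?_
        ring
    _ ≤ ∑ k ∈ Finset.univ.erase i, lennardJones (dist (y i) (y k)) :=
        Finset.sum_le_sum fun k hk =>
          neg_le_lennardJones_of_le (hδ.trans_le (hsep i k (Finset.ne_of_mem_erase hk).symm)) le_rfl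

/-- (R1) at the proved ground-state separation `7/10`: `m = −(250/6)·(10/7)⁶ ≈ −354.2`. -/
theorem siteFloor_seven_tenths_crude : SiteFloor (7 / 10) (-(250 / 6 * (7 / 10 : ℝ)⁻¹ ^ 6)) := siteFloor_of_separated (by norm_num)

/-- **(R2) THE CORE/TAIL RUNG**: for `0 < δ ≤ r`, `SiteFloor δ (−(1/12)·((2r/δ+1)³ − 1) − (250/6)·δ⁻³·r⁻³)` — the at most `(2r/δ+1)³ − 1` neighbours
within distance `r` (`core_card`) cost at most the well depth `1/12` each, the neighbours beyond `r` cost at most the tail `site_tail`. -/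
theorem siteFloor_core_tail {δ r : ℝ} (hδ : 0 < δ) (hδr : δ ≤ r) :
    SiteFloor δ (-(1 / 12 * ((2 * r / δ + 1) ^ 3 - 1)) - 250 / 6 * δ⁻¹ ^ 3 * r⁻¹ ^ 3) := by
  intro N y hy hsep i
  have hr : 0 ≤ r := hδ.le.trans hδr
  set S : Finset (Fin N) := Finset.univ.erase i with hS
  set T₁ : Finset (Fin N) := S.filter (fun k : Fin N => dist (y k) (y i) ≤ r) with hT₁
  set T₂ : Finset (Fin N) := S.filter (fun k : Fin N => ¬ dist (y k) (y i) ≤ r) with hT₂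
  set F : Finset (Fin N) := Finset.univ.filter (fun k : Fin N => dist (y k) (y i) ≤ r) with hF
  have hsplit : ∑ k ∈ S, lennardJones (dist (y i) (y k))
      = ∑ k ∈ T₁, lennardJones (dist (y i) (y k)) + ∑ k ∈ T₂, lennardJones (dist (y i) (y k)) :=
    (Finset.sum_filter_add_sum_filter_not S (fun k : Fin N => dist (y k) (y i) ≤ r) (fun k => lennardJones (dist (y i) (y k)))).symm
  -- the near part
  have hcore : (F.card : ℝ) ≤ (2 * r / δ + 1) ^ 3 := by
    have hcard : (F.image y).card = F.card := Finset.card_image_of_injective F hy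
    have hs : ∀ c ∈ F.image y, dist c (y i) ≤ r := by
      intro c hc
      obtain ⟨k, hk, rfl⟩ := Finset.mem_image.1 hc
      exact (Finset.mem_filter.1 hk).2
    have hsep' : ∀ c ∈ F.image y, ∀ d ∈ F.image y, c ≠ d → δ ≤ dist c d := by
      intro c hc d hd hcd
      obtain ⟨k, _, rfl⟩ := Finset.mem_image.1 hc
      obtain ⟨l, _, rfl⟩ := Finset.mem_image.1 hd
      exact hsep k l fun hkl => hcd (by rw [hkl])
    have h := card_le_of_separated_of_dist_le (F.image y) (y i) hδ hr hs hsep'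
    rw [finrank_euclideanSpace_fin, hcard] at h
    exact_mod_cast h
  have hsubT : T₁ ⊆ F := fun k hk => Finset.mem_filter.mpr ⟨Finset.mem_univ _, (Finset.mem_filter.mp hk).2⟩
  have hiF : i ∈ F := Finset.mem_filter.mpr ⟨Finset.mem_univ _, by rw [dist_self]; exact hr⟩
  have hiT₁ : i ∉ T₁ := fun h => by
    have h' := (Finset.mem_filter.mp h).1
    rw [hS] at h'
    exact (Finset.notMem_erase i Finset.univ) h'
  have hss : T₁ ⊂ F := (Finset.ssubset_iff_of_subset hsubT).mpr ⟨i, hiF, hiT₁⟩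
  have hlt : T₁.card + 1 ≤ F.card := Nat.succ_le_of_lt (Finset.card_lt_card hss)
  have hcard₁ : (T₁.card : ℝ) + 1 ≤ (2 * r / δ + 1) ^ 3 := by
    have h' : ((T₁.card + 1 : ℕ) : ℝ) ≤ (F.card : ℝ) := by exact_mod_cast hlt
    push_cast at h'
    linarith
  have hnear : -(1 / 12 * ((2 * r / δ + 1) ^ 3 - 1)) ≤ ∑ k ∈ T₁, lennardJones (dist (y i) (y k)) := by
    have h1 : ∑ k ∈ T₁, (-1 / 12 : ℝ) ≤ ∑ k ∈ T₁, lennardJones (dist (y i) (y k)) :=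
      Finset.sum_le_sum fun k _ => neg_one_div_le_lennardJones _
    rw [Finset.sum_const, nsmul_eq_mul] at h1
    have h2 : -(1 / 12 * ((2 * r / δ + 1) ^ 3 - 1)) ≤ (T₁.card : ℝ) * (-1 / 12) := by linarith
    exact h2.trans h1
  -- the far part
  have hfar : -((1 / 6) * (250 * δ⁻¹ ^ 3 * r⁻¹ ^ 3)) ≤ ∑ k ∈ T₂, lennardJones (dist (y i) (y k)) := by
    have hT : ∀ k ∈ T₂, r ≤ dist (y i) (y k) := fun k hk => by
      rw [dist_comm]; exact (not_le.mp (Finset.mem_filter.mp hk).2).le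
    have hrpos : 0 < r := hδ.trans_le hδr
    have hterm : ∀ k ∈ T₂, -((1 / 6) * (dist (y i) (y k))⁻¹ ^ 6) ≤ lennardJones (dist (y i) (y k)) := fun k hk =>
      neg_le_lennardJones_of_le (hrpos.trans_le (hT k hk)) le_rfl
    have hsumT : -((1 / 6) * ∑ k ∈ T₂, (dist (y i) (y k))⁻¹ ^ 6) ≤ ∑ k ∈ T₂, lennardJones (dist (y i) (y k)) := by
      rw [Finset.mul_sum, ← Finset.sum_neg_distrib]
      exact Finset.sum_le_sum hterm
    have h2 := sum_inv_pow_six_le_two_scale_idx y T₂ (y i) hδ hδr (fun k _ l _ hkl => hsep k l hkl) hT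
    linarith
  unfold siteEnergy
  rw [← hS, hsplit]
  linarith

/-- (R2) at the proved ground-state separation `7/10`, core radius `19/10`: **`SiteFloor (7/10) (−40)`**
(`(1/12)((45/7)³ − 1) + (250/6)(10/7)³(10/19)³ = 22.05… + 17.71… < 40`). -/
theorem siteFloor_seven_tenths_forty : SiteFloor (7 / 10) (-40) := by
  have h := siteFloor_core_tail (δ := 7 / 10) (r := 19 / 10) (by norm_num) (by norm_num)
  refine siteFloor_mono_m ?_ h
  norm_num

/-- The rung order at `d = 7/10`: (R2)'s `−40` implies (R1)'s `−354.2…`. -/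
theorem siteFloor_seven_tenths_crude_of_forty : SiteFloor (7 / 10) (-(250 / 6 * (7 / 10 : ℝ)⁻¹ ^ 6)) :=
  siteFloor_mono_m (by norm_num) siteFloor_seven_tenths_forty

/-- **THE EXPLICIT SLACK**: `MarkedSlack F 20` for EVERY marker — marked matter of a ground state is at most `20` per particle below `e⋆` on the
admissible windows ((R2) at `7/10` + `UnimodularEnergy.eStar_nonpos` + `markedSlack_of_siteFloor_seven_tenths`). -/
theorem markedSlack_twenty (F : SiteMarker) : MarkedSlack F 20 :=
  markedSlack_of_siteFloor_seven_tenths siteFloor_seven_tenths_forty (by linarith [eStar_nonpos]) F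

/-- The crude version from (R1): `MarkedSlack F ((125/6)·(10/7)⁶)` (`≈ 177.1`). -/
theorem markedSlack_crude (F : SiteMarker) : MarkedSlack F (125 / 6 * (7 / 10 : ℝ)⁻¹ ^ 6) :=
  markedSlack_of_siteFloor_seven_tenths siteFloor_seven_tenths_crude (by linarith [eStar_nonpos]) F

/-- **NEAR(φ) FROM PAY ALONE, explicit fraction**: PAY(κ₀) gives NEAR(φ) for every `φ` with `φ(κ₀+20) < κ₀`. -/
theorem markedNearGapAt_of_pay_twenty {F : SiteMarker} {κ₀ φ : ℝ} (hκ₀ : 0 ≤ κ₀) (hφ : φ * (κ₀ + 20) < κ₀) (hP : MarkedPay F κ₀) :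
    MarkedNearGapAt F φ :=
  markedNearGapAt_of_pay_slack hκ₀ (by norm_num) hφ hP (markedSlack_twenty F)

/-- **THE EXPLICIT-THRESHOLD CUT** (modulo the window ceiling): NLC ⟸ PAY(κ₀) ∧ «Φ_∞(F) < κ₀/(κ₀+20)». -/
theorem noLooseChunks_of_pay_dip_twenty (hC : GSWindowCeiling) {F : SiteMarker} {κ₀ : ℝ} (hκ₀ : 0 < κ₀) (hP : MarkedPay F κ₀)
    (hD : markedProfileInf F < κ₀ / (κ₀ + 20)) : NoLooseChunks :=
  noLooseChunks_of_pay_slack_dip hC hκ₀ (by norm_num) hP (markedSlack_twenty F) hD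

/-- … in one-radius form: PAY(κ₀) and ONE rung `NoMarkedChunkAt F ρ φ` at a radius `ρ ≥ 1` with `0 ≤ φ`, `φ(κ₀+20) < κ₀` give NLC. -/
theorem noLooseChunks_of_pay_rung_twenty (hC : GSWindowCeiling) {F : SiteMarker} {κ₀ ρ φ : ℝ} (hκ₀ : 0 < κ₀) (hP : MarkedPay F κ₀)
    (hρ : 1 ≤ ρ) (hφ0 : 0 ≤ φ) (hφ : φ * (κ₀ + 20) < κ₀) (hR : NoMarkedChunkAt F ρ φ) : NoLooseChunks := by
  have hpos : (0 : ℝ) < κ₀ + 20 := by linarith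
  obtain ⟨φ', hφφ', hφ'⟩ := exists_between ((lt_div_iff₀ hpos).mpr hφ)
  exact noLooseChunks_of_nearAt_rung hC (markedNearGapAt_of_pay_twenty hκ₀.le ((lt_div_iff₀ hpos).mp hφ') hP) hρ hφ0 hφφ' hR

/-- … or ONE open implant door there. -/
theorem noLooseChunks_of_pay_door_twenty (hC : GSWindowCeiling) {F : SiteMarker} {κ₀ ρ φ : ℝ} (hκ₀ : 0 < κ₀) (hP : MarkedPay F κ₀)
    (hρ : 1 ≤ ρ) (hφ0 : 0 ≤ φ) (hφ : φ * (κ₀ + 20) < κ₀) (hD : MarkedImplantDoor F ρ φ) : NoLooseChunks :=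
  noLooseChunks_of_pay_rung_twenty hC hκ₀ hP hρ hφ0 hφ (noMarkedChunkAt_of_implantDoor hD)

end Summit.AtomisticToContinuum.Crystallization.Theorems.ContactSaturationLadderChunkDoor

end
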